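import Literature.NumberTheory.EllipticCurves.HeegnerPointsKolyvaginPrimaryRamifiedProofs
import HarnessLib

/-!
# K7t crux `UpperOffV0HSYPlus` (item 19804), line `offv0-kolyvagin2`, toward the `2`-adic local
# clause `h44`: McCallum's Prop. 4.4 local criterion with the ODD-`p` step isolated as one hypothesis

Helper file of route `SylvesterTwoHeegnerIndex` (cell bsd-cm, rung K7t).  The one `2`-SPECIFIC open
input of k7t-c2 g6's assembled stub (d) at `2` (`hpoints_at_two_of_perLevelChoice_sylvester`) is the
local clause `h44` = McCallum 1991 Prop. 4.4 at `λ ∣ m`.  In the tree that clause rests on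
`zsmul_kolyvaginClass_mem_selmerLocalKer_iff_mem_torsionLocalKer`
(`HeegnerPointsKolyvaginPrimaryRamifiedProofs` §4–§5), whose ONLY use of `p ≠ 2` is §1, the
finite-group lemma `KolyvaginChi.sub_eq_zero_iff_exists_pow_zsmul_eq`: «`ker χ_l = p^M Ẽ(F_λ)`» from
"the `Gal(K/ℚ)`-eigenspaces of `Ẽ(F_λ)` are cyclic" by the eigen-decomposition `y = u + w`, which
needs `2` invertible.  THIS FILE re-runs the criterion with that conclusion as a HYPOTHESIS `hχ`, for
every prime `p`:

* `zsmul_kolyvaginClass_mem_selmerLocalKer_iff_mem_torsionLocalKer_of_kerChi` — Prop. 4.4 in order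
  form from the abstract reduction datum, §2 verbatim, §1 := `hχ`;
* `zsmul_kolyvaginClass_mem_selmerLocalKer_iff_of_isKolyvaginPrime_of_kerChi` — the same at a
  Kolyvagin prime of level `M` (the tree supplies `λ ∤ p`, the local prime, the Frobenius fixing
  `E[p^M]`, `E(K̄)[p^M] ≃ E(K̄_λ)[p^M]`), granted the datum `hdata` with `hχ` in place of
  (`htors`, `hchar`, `hcyc`).

So the `2`-adic local clause of the line reduces to: the x11b3 reduction-datum construction
(`X11b.KolyvaginReductionDatum.exists_reductionDatum`, `p` odd) re-done at `2` for `E_p` with `hχ`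
proved by the free-module mechanism (`a_ℓ(E_p) = 0` at the Kolyvagin primes `ℓ ≡ 2 (3)` — tree
`frobeniusTrace_eq_zero_of_j_eq_zero_of_mod_three_eq_two`; `χ = −l'φ`; `Ẽ(𝔽_{ℓ²}) = Ẽ[ℓ+1]`;
`ker χ = Ẽ[l'] = 2^M Ẽ[ℓ+1]`), plus the `p`-free wrappers of the `h44` chain.  HONEST FRAMING: a re-run
of the tree's proof with one step abstracted; proves nothing at `2` by itself; no definition, no named
fact, no `sorry`; B14 = O12 open as a class; BSD not claimed.
References: [McCallumLMS1991] §4 Prop. 4.4, Lemma 4.3; [GrossLMS1991] §3 (3.2)–(3.4), Prop. 6.2 (2).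
-/

set_option autoImplicit false
set_option linter.dupNamespace false

noncomputable section

open scoped Classical
open WeierstrassCurve NumberField IsDedekindDomain Field Finset
open Literature.NumberTheory.GaloisRepresentations
open Literature.NumberTheory.EllipticCurves
open Literature.NumberTheory.EllipticCurves.KolyvaginCocycle

universe u

namespace Summit.BirchSwinnertonDyer.BirchSwinnertonDyer.Theorems.SylvesterTwoUpper

section Ramified

variable {K : Type u} [Field K] [NumberField K] (W : WeierstrassCurve K) [W.IsElliptic]

set_option maxHeartbeats 800000 in
/-- **McCallum 1991, Prop. 4.4 (Gross 1991, Prop. 6.2 (2)) in order form, from an abstract reduction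
datum at `λ` — with the step «`ker χ_l = p^M Ẽ(F_λ)`» as a HYPOTHESIS (`hχ`), for ANY prime `p`.**
The tree's `zsmul_kolyvaginClass_mem_selmerLocalKer_iff_mem_torsionLocalKer` token for token, except
that its finite-group inputs on `Ẽ(F_λ) = {φ² = 1}` (`htors`, `hchar`, and the CYCLIC-EIGENSPACE
hypothesis `hcyc`, from which §1 `KolyvaginChi.sub_eq_zero_iff_exists_pow_zsmul_eq` derives
`ker χ_l = p^M Ẽ(F_λ)` using `p` ODD) are replaced by that conclusion itself:
`hχ : ∀ b, φ²b = b → (a'b − l'φb = 0 ↔ ∃ y, φ²y = y ∧ p^M y = b)`.  §2 of the printed proof (left side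
`= k · red R₀ = 0`, right side `= k P̃_m ∈ p^M Ẽ(F_λ)`) is `p`-free and is re-run verbatim.  At odd `p`
`hχ` is the tree's §1; at `p = 2` for the Sylvester curves (`a_ℓ = 0`, `Ẽ(𝔽_{ℓ²}) = Ẽ[ℓ+1]` free of
rank `2`) it is the «free-module» mechanism (memo STUB-AUDIT-19804 §2) — NOT proved here.
[cite: McCallumLMS1991, Prop. 4.4] [cite: GrossLMS1991, Prop. 6.2 (2)] -/
theorem zsmul_kolyvaginClass_mem_selmerLocalKer_iff_mem_torsionLocalKer_of_kerChi
    {p : ℕ} (hp : p.Prime) {M : ℕ}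
    {hdiv : ∀ P : geomPoints W, ∃ Q : geomPoints W, ((p ^ M : ℕ) : ℤ) • Q = P}
    {A₁ A₂ : AddSubgroup (geomPoints W)}
    (hA₁ : IsAdmissible (absoluteGaloisGroup K) A₁ ((p ^ M : ℕ) : ℤ))
    (hA₂ : IsAdmissible (absoluteGaloisGroup K) A₂ ((p ^ M : ℕ) : ℤ))
    {P₁ P₂ : geomPoints W}
    (hP₁ : P₁ ∈ invPoints (absoluteGaloisGroup K) A₁ ((p ^ M : ℕ) : ℤ))
    (hP₂ : P₂ ∈ invPoints (absoluteGaloisGroup K) A₂ ((p ^ M : ℕ) : ℤ))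
    -- the place `λ`
    {v : HeightOneSpectrum (𝓞 K)} (hgood : W.HasGoodReductionAt v) (hpv : (p : 𝓞 K) ∉ v.asIdeal)
    {𝔐 : Ideal (HeightOneSpectrum.localAbsIntegers v)} (h𝔐 : 𝔐 ∈ v.localPrimesAbove)
    {F : absoluteGaloisGroup K}
    (hF : IsArithFrobAt (𝓞 K) F (v.primeBelow (closureEmb (K := K) (v.adicCompletion K)) 𝔐))
    (hFfix : F ∈ torsionFixing W ((p ^ M : ℕ) : ℤ))
    (hsurj : Function.Surjective (torsionPointsMap W (v.adicCompletion K) ((p ^ M : ℕ) : ℤ)))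
    -- the reduction datum at `𝔓`
    {B : Type*} [AddCommGroup B] (red : geomPoints W →+ B) (φ : B →+ B)
    (hredI : ∀ τ ∈ (v.primeBelow (closureEmb (K := K) (v.adicCompletion K)) 𝔐).inertia
      (absoluteGaloisGroup K), ∀ x : geomPoints W, red (τ • x) = red x)
    (hredF : ∀ x : geomPoints W, red (F • x) = φ (φ (red x)))
    (hred : ∀ x : geomPoints W, ((p ^ M : ℕ) : ℤ) • x = 0 → red x = 0 → x = 0)
    (hBn : ∀ b : B, ((p ^ M : ℕ) : ℤ) • b = 0 → φ (φ b) = b)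
    -- the arithmetic of `Ẽ(F_λ) = {φ² = 1}`: McCallum's `ker χ_l = p^M Ẽ(F_λ)` as a HYPOTHESIS
    {l' a' : ℤ}
    (hχ : ∀ b : B, φ (φ b) = b →
      (a' • b - l' • φ b = 0 ↔ ∃ y : B, φ (φ y) = y ∧ ((p : ℤ) ^ M) • y = b))
    -- the Euler-system data at `λ`
    {τ₀ : absoluteGaloisGroup K}
    (hτ₀ : τ₀ ∈ (v.primeBelow (closureEmb (K := K) (v.adicCompletion K)) 𝔐).inertia
      (absoluteGaloisGroup K))
    (hIτ₀ : ∀ τ ∈ (v.primeBelow (closureEmb (K := K) (v.adicCompletion K)) 𝔐).inertia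
      (absoluteGaloisGroup K), ∃ i : ℕ, ∀ x ∈ A₁, τ • x = (τ₀ ^ i) • x)
    {R₀ : geomPoints W} (hR₀A : R₀ ∈ A₁) (hR₀ : ((p ^ M : ℕ) : ℤ) • R₀ = τ₀ • P₁ - P₁)
    (hR₀red : red R₀ = l' • φ (red P₂) - a' • red P₂)
    (hFP₂ : F • P₂ = P₂)
    (hsel₂ : kolyvaginClass W _ hdiv hA₂ P₂ hP₂ ∈
      selmerLocalKer W (v.adicCompletion K) ((p ^ M : ℕ) : ℤ))
    (k : ℤ) :
    k • kolyvaginClass W _ hdiv hA₁ P₁ hP₁ ∈ selmerLocalKer W (v.adicCompletion K) ((p ^ M : ℕ) : ℤ) ↔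
      k • kolyvaginClass W _ hdiv hA₂ P₂ hP₂ ∈
        W.torsionLocalKer (v.adicCompletion K) ((p ^ M : ℕ) : ℤ) := by
  set 𝔓 := v.primeBelow (closureEmb (K := K) (v.adicCompletion K)) 𝔐 with h𝔓def
  have h𝔓 : 𝔓 ∈ v.primesAbove := HeightOneSpectrum.primeBelow_mem_primesAbove h𝔐
  have hnZ : ((p ^ M : ℕ) : ℤ) = (p : ℤ) ^ M := by push_cast; rfl
  have hn0 : ((p ^ M : ℕ) : ℤ) ≠ 0 := by exact_mod_cast pow_ne_zero M hp.ne_zero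
  have hnv : ((((p ^ M : ℕ) : ℤ)) : 𝓞 K) ∉ v.asIdeal := by
    rw [Int.cast_natCast, Nat.cast_pow]
    exact fun h ↦ hpv (v.isPrime.mem_of_pow_mem M h)
  -- ### left side: `k · red R₀ = 0`
  have hL : k • kolyvaginClass W _ hdiv hA₁ P₁ hP₁ ∈
      selmerLocalKer W (v.adicCompletion K) ((p ^ M : ℕ) : ℤ) ↔ k • red R₀ = 0 := by
    rw [zsmul_kolyvaginClass_mem_selmerLocalKer_iff_of_red W hA₁ hP₁ hgood hnv h𝔓 red hredI
      hred k]
    have hroot : rootIn A₁ ((p ^ M : ℕ) : ℤ) (τ₀ • P₁ - P₁) = R₀ :=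
      rootIn_eq hA₁.eq_zero_of_zsmul hR₀A hR₀
    constructor
    · intro h
      have h0 := h τ₀ hτ₀
      rwa [hroot] at h0
    · intro h τ hτ
      obtain ⟨i, hi⟩ := hIτ₀ τ hτ
      rw [hi P₁ hP₁.1, rootIn_pow_smul_sub hA₁ hP₁ τ₀ i, hroot, map_sum,
        sum_congr rfl fun j _ ↦ hredI _ (pow_mem hτ₀ j) R₀, sum_const, card_range,
        ← natCast_zsmul, zsmul_comm, h, zsmul_zero]
  -- ### the subgroup `B₀ = {φ² = 1}` (`Ẽ(F_λ)`) and `χ` on it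
  set φ2 : B →+ B := φ.comp φ with hφ2def
  have hφ2 : ∀ b, φ2 b = φ (φ b) := fun b ↦ rfl
  set B₀ : AddSubgroup B := φ2.eqLocus (AddMonoidHom.id B) with hB₀def
  have hmemB₀ : ∀ {b : B}, b ∈ B₀ ↔ φ (φ b) = b := fun {b} ↦ Iff.rfl
  have hφB₀ : ∀ b ∈ B₀, φ b ∈ B₀ := fun b hb ↦ by
    rw [hmemB₀] at hb ⊢
    rw [hb]
  -- `P̃₂ ∈ B₀`
  have hP₂B₀ : k • red P₂ ∈ B₀ := by
    refine B₀.zsmul_mem ?_ k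
    rw [hmemB₀, ← hredF, hFP₂]
  -- ### right side: `k P̃₂ ∈ n B₀`
  have hR : k • kolyvaginClass W _ hdiv hA₂ P₂ hP₂ ∈
      W.torsionLocalKer (v.adicCompletion K) ((p ^ M : ℕ) : ℤ) ↔
      ∃ y : B₀, ((p : ℤ) ^ M) • y = ⟨k • red P₂, hP₂B₀⟩ := by
    rw [zsmul_kolyvaginClass_mem_torsionLocalKer_iff_of_red W hA₂ hP₂ hgood hnv hn0 h𝔐 hF hFfix
      hsurj hsel₂ hFP₂ red φ2 (fun x ↦ hredF x) hred (fun b hb ↦ hBn b hb) k]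
    constructor
    · rintro ⟨b, hb, hkb⟩
      exact ⟨⟨b, hb⟩, Subtype.ext (by rw [AddSubgroupClass.coe_zsmul, ← hnZ]; exact hkb.symm)⟩
    · rintro ⟨y, hy⟩
      refine ⟨y, y.2, ?_⟩
      have h := congrArg Subtype.val hy
      rw [AddSubgroupClass.coe_zsmul, ← hnZ] at h
      exact h.symm
  rw [hL, hR]
  -- ### `k · red R₀ = 0 ⟺ χ(k P̃₂) = 0` with `χ(c) = a' c - l' φ(c)`, on `B`
  have hmid : k • red R₀ = 0 ↔ a' • (k • red P₂) - l' • φ (k • red P₂) = 0 := by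
    rw [hR₀red, zsmul_sub, smul_comm k l', smul_comm k a', ← map_zsmul,
      ← neg_sub (a' • (k • red P₂)), neg_eq_zero]
  rw [hmid, hχ _ (hmemB₀.mp hP₂B₀)]
  constructor
  · rintro ⟨y, hy, hyb⟩
    exact ⟨⟨y, hmemB₀.mpr hy⟩, Subtype.ext (by rw [AddSubgroupClass.coe_zsmul]; exact hyb)⟩
  · rintro ⟨y, hy⟩
    exact ⟨y, hmemB₀.mp y.2, by
      have h := congrArg Subtype.val hy
      rwa [AddSubgroupClass.coe_zsmul] at h⟩


end Ramified

section KolyvaginPrime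

variable {K : Type u} [Field K] [NumberField K] (W : WeierstrassCurve ℚ)

/-- **McCallum's Prop. 4.4 in order form at a Kolyvagin prime of level `M`, for ANY prime `p`,
granted the reduction datum modulo the primes `𝔓 ∣ λ` with «`ker χ_l = p^M Ẽ(F_λ)`» in place of the
cyclic-eigenspace data** — the tree's `zsmul_kolyvaginClass_mem_selmerLocalKer_iff_of_isKolyvaginPrime`
token for token with the conjuncts `htors`, `hchar`, `hcyc` of `hdata` replaced by `hχ` (and `p ≠ 2`,
`hl'`, `ha'` dropped). [cite: McCallumLMS1991, Prop. 4.4] [cite: GrossLMS1991, Prop. 6.2 (2)] -/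
theorem zsmul_kolyvaginClass_mem_selmerLocalKer_iff_of_isKolyvaginPrime_of_kerChi [W.IsElliptic]
    (hK : IsImaginaryQuadratic K) {N p : ℕ} (hp : p.Prime) {M ℓ : ℕ}
    (hℓ : IsKolyvaginPrime N W K p ℓ) (hℓM : FrobEqFrobInfty W K (p ^ M) ℓ)
    {v : HeightOneSpectrum (𝓞 K)} (hv : (ℓ : 𝓞 K) ∈ v.asIdeal)
    (hgood : (W.baseChange K).HasGoodReductionAt v)
    {hdiv : ∀ P : geomPoints (W.baseChange K), ∃ Q : geomPoints (W.baseChange K),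
      ((p ^ M : ℕ) : ℤ) • Q = P}
    {A₁ A₂ : AddSubgroup (geomPoints (W.baseChange K))}
    (hA₁ : IsAdmissible (absoluteGaloisGroup K) A₁ ((p ^ M : ℕ) : ℤ))
    (hA₂ : IsAdmissible (absoluteGaloisGroup K) A₂ ((p ^ M : ℕ) : ℤ))
    {P₁ P₂ : geomPoints (W.baseChange K)}
    (hP₁ : P₁ ∈ invPoints (absoluteGaloisGroup K) A₁ ((p ^ M : ℕ) : ℤ))
    (hP₂ : P₂ ∈ invPoints (absoluteGaloisGroup K) A₂ ((p ^ M : ℕ) : ℤ))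
    (hsel₂ : kolyvaginClass (W.baseChange K) _ hdiv hA₂ P₂ hP₂ ∈
      selmerLocalKer (W.baseChange K) (v.adicCompletion K) ((p ^ M : ℕ) : ℤ))
    {l' a' : ℤ}
    (hdata : ∀ 𝔓 ∈ v.primesAbove, ∀ F : absoluteGaloisGroup K, IsArithFrobAt (𝓞 K) F 𝔓 →
      F ∈ torsionFixing (W.baseChange K) ((p ^ M : ℕ) : ℤ) →
      F • P₂ = P₂ ∧
      ∃ (B : Type u) (_ : AddCommGroup B) (red : geomPoints (W.baseChange K) →+ B) (φ : B →+ B)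
        (τ₀ : absoluteGaloisGroup K) (R₀ : geomPoints (W.baseChange K)),
        (∀ τ ∈ 𝔓.inertia (absoluteGaloisGroup K), ∀ x : geomPoints (W.baseChange K),
          red (τ • x) = red x) ∧
        (∀ x : geomPoints (W.baseChange K), red (F • x) = φ (φ (red x))) ∧
        (∀ x : geomPoints (W.baseChange K), ((p ^ M : ℕ) : ℤ) • x = 0 → red x = 0 → x = 0) ∧
        (∀ b : B, ((p ^ M : ℕ) : ℤ) • b = 0 → φ (φ b) = b) ∧
        (∀ b : B, φ (φ b) = b →
          (a' • b - l' • φ b = 0 ↔ ∃ y : B, φ (φ y) = y ∧ ((p : ℤ) ^ M) • y = b)) ∧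
        τ₀ ∈ 𝔓.inertia (absoluteGaloisGroup K) ∧
        (∀ τ ∈ 𝔓.inertia (absoluteGaloisGroup K), ∃ i : ℕ, ∀ x ∈ A₁, τ • x = (τ₀ ^ i) • x) ∧
        R₀ ∈ A₁ ∧ ((p ^ M : ℕ) : ℤ) • R₀ = τ₀ • P₁ - P₁ ∧
        red R₀ = l' • φ (red P₂) - a' • red P₂)
    (k : ℤ) :
    k • kolyvaginClass (W.baseChange K) _ hdiv hA₁ P₁ hP₁ ∈
        selmerLocalKer (W.baseChange K) (v.adicCompletion K) ((p ^ M : ℕ) : ℤ) ↔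
      k • kolyvaginClass (W.baseChange K) _ hdiv hA₂ P₂ hP₂ ∈
        (W.baseChange K).torsionLocalKer (v.adicCompletion K) ((p ^ M : ℕ) : ℤ) := by
  have hvw : v = hℓ.place := hℓ.mem_iff.mp hv
  subst hvw
  haveI : CharZero (hℓ.place.adicCompletion K) :=
    charZero_of_injective_algebraMap (algebraMap K (hℓ.place.adicCompletion K)).injective
  have hq0 : p ^ M ≠ 0 := pow_ne_zero M hp.ne_zero
  have hpv : (p : 𝓞 K) ∉ hℓ.place.asIdeal :=
    not_natCast_mem_of_prime_ne hℓ.prime hp hℓ.2.2.2.1 _ hℓ.mem_place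
  obtain ⟨𝔐, h𝔐⟩ := hℓ.place.localPrimesAbove_nonempty
  have h𝔓 : hℓ.place.primeBelow (closureEmb (K := K) (hℓ.place.adicCompletion K)) 𝔐 ∈
      hℓ.place.primesAbove := HeightOneSpectrum.primeBelow_mem_primesAbove h𝔐
  obtain ⟨F, hF, hFfix⟩ := exists_isArithFrobAt_mem_torsionFixing W hK hℓ hℓM h𝔓
  obtain ⟨hFP₂, B, _, red, φ, τ₀, R₀, hredI, hredF, hred, hBn, hχ, hτ₀, hIτ₀,
    hR₀A, hR₀, hR₀red⟩ := hdata _ h𝔓 F hF hFfix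
  exact zsmul_kolyvaginClass_mem_selmerLocalKer_iff_mem_torsionLocalKer_of_kerChi (W.baseChange K) hp
    hA₁ hA₂ hP₁ hP₂ hgood hpv h𝔐 hF hFfix
    (torsionPointsMap_bijective (W.baseChange K) (hℓ.place.adicCompletion K) hq0).2 red φ hredI
    hredF hred hBn hχ hτ₀ hIτ₀ hR₀A hR₀ hR₀red hFP₂ hsel₂ k


end KolyvaginPrime

end Summit.BirchSwinnertonDyer.BirchSwinnertonDyer.Theorems.SylvesterTwoUpper

end
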